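import Mathlib

/-!
# GridStability/Models/InverterVSM — virtual synchronous machine (VSM) outer loop and matching control: printed reduced models

Cell `gridfusion` (LADDER-GRIDFUSION, rung G3 «inverter models», seat model-3), staged under
`HOME/lean/` until gate5 opens `lean/Summits/Ventures/GridStability/` (PARTITION §0).

THREE COLUMNS. Everything here is the MODELLED column: the virtual-inertia («VSM») outer loop of a
grid-forming converter and the «matching control» closed loop, typed AS PRINTED with equation
locators. No statement about the stability of any converter or grid is made; a certificate about
one of these vector fields concerns the MODEL named in its docstring; model fidelity is a separate
VALIDATED claim (plan/MODEL-VALIDITY.md, MV-INV-*).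

## Sources (read on the page this session; tags are the printed equation numbers)

* [cite: HenriquezAuba2022] R. Henriquez-Auba, PhD thesis UC Berkeley (UCB/EECS-2022-264, 2022),
  §2.4 eqs. (2.6)–(2.9) = §2.5 eqs. (2.59a)–(2.59d): VSM outer control
  `θ̇ = Ω_b(ω − ω_s)`, `ω̇ = (1/M)[(p* − p_e) + (1/k_p)(ω* − ω)]`, `q̇_f = ω_z(q_e − q_f)`,
  `ṽ_d = v* + k_q(q* − q_f)` («a virtual inertia model as described in [78]» = D'Arco–Suul), and the
  Remark after (2.9) (droop-with-filter has the same steady state iff `M = 1/(ω_z k_p)`).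
* [cite: DarcoSuulFosso2015] S. D'Arco, J. A. Suul, O. B. Fosso, Int. J. Electr. Power Energy Syst.
  72 (2015) 3–15, §«VSM swing equation and inertia emulation» with Fig. 5: the swing equation is
  «linearized with respect to the speed so that the power balance determines the acceleration of
  the inertia»; «`p^{r*}` is the virtual mechanical input power, `p` the measured electrical power,
  and the mechanical time constant is `T_a` (corresponding to `2H` in a traditional SM)»; «the VSM
  damping power `p_d` … is defined by the damping constant `k_d` and the difference between the VSM
  speed and the actual grid frequency» (provided by a PLL); «an external steady-state frequency
  droop … droop constant `k_ω` acting on the difference between the frequency reference `ω*_VSM`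
  and the actual VSM speed», plus «an external power reference `p*`» (the display of eq. (13) is not
  legible in the held text extraction: the term structure below is the one stated in this prose,
  flagged PROSE-SOURCED).
* [cite: JouiniSun2022] T. Jouini, Z. Sun, IEEE TCNS (arXiv:2007.14064) §2.1, the displayed
  closed-loop «matching control» converter model (after Arghir–Jouini–Groß–Dörfler 2018):
  `γ̇ = η (v_dc − v_dc*)`, `C_dc v̇_dc = −K_p (v_dc − v_dc*) − (μ/2) r(γ)ᵀ i + i*_dc`,
  `L i̇ = −(R I + L ω* J) i + (μ/2) r(γ) v_dc − v`, `C v̇ = −(G I + C ω* J) v + i − i_net`,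
  `r(γ) = (−sin γ, cos γ)ᵀ`, `J = [[0, −1], [1, 0]]` («match one-to-one those of a synchronous
  machine with single-pole pair, non-salient rotor under constant excitation»).

## What is typed

§1 the VSM outer loop (2.59a)–(2.59d) and its swing-equation identity; §2 the closed reduced model
against an infinite bus with a quasi-static power–angle map and its POLYNOMIALISED form with the
exact embedding lemma; §3 the D'Arco–Suul term structure with PLL-referred damping (PROSE-SOURCED);
§4 the matching-control closed loop per converter (6 states) and the observation that its only
nonlinearities are `sin γ, cos γ` times states (polynomialisable with `(s, c)`, degree 2).

## Deliberately NOT here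

The exact droop ≡ VSM change of variables (it is `InverterDroop.DroopOuterLoop.hasDerivAt_omegaOc`);
inner loops, virtual impedance, filter/line dynamics ((2.10)–(2.23)); reactive-power/voltage loop
interaction with the network beyond the printed first-order filter; dc-side source dynamics other
than the printed matching-control capacitor equation. No parameter values (model-4 custody).
-/

noncomputable section

open Real

namespace Summit.Ventures.GridStability.Models.InverterVSM

/-! ## §1 VSM outer control as printed -/

/-- Parameters of the VSM outer control [cite: HenriquezAuba2022, eqs. (2.59a)–(2.59d)]: base
frequency `Ω_b` [rad/s], grid SRF speed `ω_s` [pu], virtual inertia `M` [s], frequency droop `k_p`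
(damping `1/k_p` on `ω − ω*`), reactive droop `k_q`, filter cut-off `ω_z` [rad/s], set-points
`ω*, v*, p*, q*` [pu]. -/
structure VsmOuterLoop where
  /-- base angular frequency `Ω_b` [rad/s] -/
  Ωb : ℝ
  /-- angular speed `ω_s` of the grid reference frame [pu] -/
  ωs : ℝ
  /-- virtual inertia constant `M` -/
  M : ℝ
  /-- frequency droop gain `k_p` (the damping coefficient is `1/k_p`) -/
  kp : ℝ
  /-- reactive-power/voltage droop gain `k_q` -/
  kq : ℝ
  /-- cut-off `ω_z` of the reactive-power measurement filter [rad/s] -/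
  ωz : ℝ
  /-- frequency set-point `ω*` [pu] -/
  ωref : ℝ
  /-- voltage set-point `v*` [pu] -/
  vref : ℝ
  /-- active-power set-point `p*` [pu] -/
  pref : ℝ
  /-- reactive-power set-point `q*` [pu] -/
  qref : ℝ

namespace VsmOuterLoop

variable (V : VsmOuterLoop)

/-- Angle equation `θ̇ = Ω_b (ω − ω_s)` [cite: HenriquezAuba2022, eq. (2.59a) = (2.6)]. -/
def dθ (ω : ℝ) : ℝ := V.Ωb * (ω - V.ωs)

/-- Frequency equation `ω̇ = (1/M)[(p* − p_e) + (1/k_p)(ω* − ω)]`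
[cite: HenriquezAuba2022, eq. (2.59b) = (2.7)]; `p_e` = measured active power (input). -/
def dω (pe ω : ℝ) : ℝ := 1 / V.M * ((V.pref - pe) + 1 / V.kp * (V.ωref - ω))

/-- Reactive-power filter `q̇_f = ω_z (q_e − q_f)` [cite: HenriquezAuba2022, eq. (2.59c) = (2.8)]. -/
def dqf (qe qf : ℝ) : ℝ := V.ωz * (qe - qf)

/-- Voltage reference `v_oc^{d,*} = v* + k_q (q* − q_f)` [cite: HenriquezAuba2022, eq. (2.59d) = (2.9)]. -/
def voc (qf : ℝ) : ℝ := V.vref + V.kq * (V.qref - qf)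

/-- Swing-equation identity: `M ω̇ = (p* − p_e) − (1/k_p)(ω − ω*)` for `M ≠ 0`. -/
theorem M_mul_dω (hM : V.M ≠ 0) (pe ω : ℝ) :
    V.M * V.dω pe ω = (V.pref - pe) - 1 / V.kp * (ω - V.ωref) := by
  unfold dω
  field_simp
  ring

/-! ## §2 Closed reduced model against an infinite bus and its polynomialised form -/

/-- Frequency equation of the closed two-state model: (2.59b) with a quasi-static power–angle map
`p_e = P_max sin θ` (lossless coupling to an infinite bus, as in `InverterDroop.pInductive`;
[cite: Qoria2020, eq. (V-13)]). MODELLED: inner loops, filters, line dynamics quasi-static, voltage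
magnitudes frozen, no current limit. -/
def dωClosed (Pmax θ ω : ℝ) : ℝ := V.dω (Pmax * sin θ) ω

/-- A classical solution of the closed two-state VSM model. -/
structure IsSolution (Pmax : ℝ) (θ ω : ℝ → ℝ) : Prop where
  /-- `θ' = Ω_b(ω − ω_s)` -/
  angle : ∀ t, HasDerivAt θ (V.dθ (ω t)) t
  /-- `ω' = (1/M)[(p* − P_max sin θ) + (1/k_p)(ω* − ω)]` -/
  freq : ∀ t, HasDerivAt ω (V.dωClosed Pmax (θ t) (ω t)) t

/-- Equilibria of the closed model: `ω = ω_s` and the power balance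
`p* − P_max sin θ + (1/k_p)(ω* − ω_s) = 0` (a frequency offset `ω* ≠ ω_s` shifts the power
operating point through the droop term). -/
theorem equilibrium_iff (hb : V.Ωb ≠ 0) (hM : V.M ≠ 0) (Pmax θ ω : ℝ) :
    (V.dθ ω = 0 ∧ V.dωClosed Pmax θ ω = 0) ↔
      (ω = V.ωs ∧ V.pref - Pmax * sin θ + 1 / V.kp * (V.ωref - V.ωs) = 0) := by
  constructor
  · rintro ⟨h1, h2⟩
    have hω : ω = V.ωs := by
      unfold dθ at h1
      rcases mul_eq_zero.mp h1 with h | h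
      · exact absurd h hb
      · linarith
    refine ⟨hω, ?_⟩
    unfold dωClosed dω at h2
    rw [hω] at h2
    rcases mul_eq_zero.mp h2 with h | h
    · exfalso; exact hM (by simpa using h)
    · linarith
  · rintro ⟨hω, hp⟩
    refine ⟨by simp [dθ, hω], ?_⟩
    unfold dωClosed dω
    rw [hω, hp, mul_zero]

/-- `s`-component of the polynomialised field: `ṡ = c · Ω_b (ω − ω_s)`. -/
def dS (_s c ω : ℝ) : ℝ := c * V.dθ ω

/-- `c`-component of the polynomialised field: `ċ = −s · Ω_b (ω − ω_s)`. -/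
def dC (s _c ω : ℝ) : ℝ := -(s * V.dθ ω)

/-- `ω`-component of the polynomialised field: (2.59b) with `sin θ ↦ s`; affine in `(s, ω)`. -/
def dΩ (Pmax s _c ω : ℝ) : ℝ := V.dω (Pmax * s) ω

/-- **Exact embedding** of the closed VSM model into the polynomial system `(dS, dC, dΩ)` on
`s² + c² = 1` via `(s, c, ω) = (sin θ, cos θ, ω)`. -/
theorem embedding {Pmax : ℝ} {θ ω : ℝ → ℝ} (h : V.IsSolution Pmax θ ω) (t : ℝ) :
    HasDerivAt (fun τ => sin (θ τ)) (V.dS (sin (θ t)) (cos (θ t)) (ω t)) t ∧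
    HasDerivAt (fun τ => cos (θ τ)) (V.dC (sin (θ t)) (cos (θ t)) (ω t)) t ∧
    HasDerivAt ω (V.dΩ Pmax (sin (θ t)) (cos (θ t)) (ω t)) t ∧
    sin (θ t) ^ 2 + cos (θ t) ^ 2 = 1 := by
  have hθ := h.angle t
  have hω := h.freq t
  refine ⟨?_, ?_, ?_, sin_sq_add_cos_sq (θ t)⟩
  · simpa [dS] using hθ.sin
  · simpa [dC, neg_mul] using hθ.cos
  · simpa [dΩ, dωClosed] using hω

end VsmOuterLoop

/-! ## §3 D'Arco–Suul VSM with PLL-referred damping (term structure from the printed prose) -/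

/-- Parameters of the D'Arco–Suul VSM power balance [cite: DarcoSuulFosso2015, §«VSM swing equation
and inertia emulation», Fig. 5]: mechanical time constant `T_a` (`= 2H`), damping constant `k_d`
acting on `ω_VSM − ω_PLL`, frequency droop `k_ω` acting on `ω*_VSM − ω_VSM`, references `p*`,
`ω*_VSM`, base frequency `ω_b`. PROSE-SOURCED (display eq. (13) not legible in the held copy). -/
structure DarcoSuulVsm where
  /-- mechanical time constant `T_a` (`2H`) [s] -/
  Ta : ℝ
  /-- damping constant `k_d` [pu/pu] -/
  kd : ℝ
  /-- frequency droop constant `k_ω` [pu/pu] -/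
  kω : ℝ
  /-- external power set-point `p*` [pu] -/
  pref : ℝ
  /-- frequency reference `ω*_VSM` [pu] -/
  ωref : ℝ
  /-- base angular frequency `ω_b` [rad/s] -/
  ωb : ℝ

namespace DarcoSuulVsm

variable (D : DarcoSuulVsm)

/-- Virtual mechanical input power `p^{r*} = p* + k_ω (ω*_VSM − ω_VSM)` (set-point plus external
frequency droop) [cite: DarcoSuulFosso2015, Fig. 5 prose]. PROSE-SOURCED. -/
def pMech (ω : ℝ) : ℝ := D.pref + D.kω * (D.ωref - ω)

/-- Damping power `p_d = k_d (ω_VSM − ω_PLL)` [cite: DarcoSuulFosso2015, Fig. 5 prose]: NOTE the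
damping is referred to the PLL-estimated grid frequency, so the closed model needs the PLL states
of `InverterPLL.SrfPll` (or the D'Arco PLL with `atan` phase detector, which is NOT polynomial). -/
def pDamp (ωpll ω : ℝ) : ℝ := D.kd * (ω - ωpll)

/-- Power balance of the virtual inertia, `T_a ω̇_VSM = p^{r*} − p − p_d`
[cite: DarcoSuulFosso2015, §«VSM swing equation and inertia emulation»]. PROSE-SOURCED. -/
def dω (p ωpll ω : ℝ) : ℝ := 1 / D.Ta * (D.pMech ω - p - D.pDamp ωpll ω)

/-- VSM angle `θ̇_VSM = ω_b ω_VSM` («the phase angle … is given by the integral of the speed»,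
per-unit speed times base frequency) [cite: DarcoSuulFosso2015, Fig. 5 prose]. PROSE-SOURCED. -/
def dθ (ω : ℝ) : ℝ := D.ωb * ω

/-- When the PLL tracks the VSM speed exactly (`ω_PLL = ω_VSM`, the steady state noted in the
source) the damping power vanishes and the balance reduces to inertia + droop. -/
theorem dω_of_pll_locked (p ω : ℝ) : D.dω p ω ω = 1 / D.Ta * (D.pMech ω - p) := by
  simp [dω, pDamp]

end DarcoSuulVsm

/-! ## §4 Matching control: the printed closed loop per converter -/

/-- Parameters of the matching-control closed loop [cite: JouiniSun2022, §2.1 displayed model]: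
gain `η`, modulation amplitude `μ ∈ ]0,1[`, dc capacitance `C_dc`, `K_p = G_dc + K̂_p`, dc set-point
`v_dc*`, dc source `i*_dc`, filter `R, L, C`, load conductance `G`, nominal frequency `ω*`. -/
structure Matching where
  /-- control gain `η` -/
  η : ℝ
  /-- modulation amplitude `μ` -/
  μ : ℝ
  /-- dc-link capacitance `C_dc` -/
  Cdc : ℝ
  /-- `K_p = G_dc + K̂_p` -/
  Kp : ℝ
  /-- dc-voltage set-point `v_dc*` -/
  vdcRef : ℝ
  /-- constant dc current source `i*_dc` -/
  idcRef : ℝ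
  /-- filter resistance `R` -/
  R : ℝ
  /-- filter inductance `L` -/
  L : ℝ
  /-- filter capacitance `C` -/
  C : ℝ
  /-- load conductance `G` -/
  G : ℝ
  /-- nominal frequency `ω*` -/
  ωn : ℝ

namespace Matching

variable (K : Matching)

/-- `γ̇ = η (v_dc − v_dc*)` (frequency from the dc-voltage deviation) [cite: JouiniSun2022, §2.1]. -/
def dγ (vdc : ℝ) : ℝ := K.η * (vdc - K.vdcRef)

/-- dc-link equation `C_dc v̇_dc = −K_p (v_dc − v_dc*) − (μ/2) r(γ)ᵀ i + i*_dc`, with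
`r(γ) = (−sin γ, cos γ)ᵀ`, solved for `v̇_dc` [cite: JouiniSun2022, §2.1]. -/
def dvdc (γ vdc i₁ i₂ : ℝ) : ℝ :=
  1 / K.Cdc * (-(K.Kp * (vdc - K.vdcRef)) - K.μ / 2 * (-(sin γ) * i₁ + cos γ * i₂) + K.idcRef)

/-- Inductor current, first component of `L i̇ = −(R I + L ω* J) i + (μ/2) r(γ) v_dc − v` with
`J = [[0, −1], [1, 0]]` [cite: JouiniSun2022, §2.1]: `L i̇₁ = −R i₁ + L ω* i₂ − (μ/2) sin γ · v_dc − v₁`. -/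
def di₁ (γ vdc i₁ i₂ v₁ : ℝ) : ℝ :=
  1 / K.L * (-(K.R * i₁) + K.L * K.ωn * i₂ + K.μ / 2 * (-(sin γ)) * vdc - v₁)

/-- Second component: `L i̇₂ = −R i₂ − L ω* i₁ + (μ/2) cos γ · v_dc − v₂` [cite: JouiniSun2022, §2.1]. -/
def di₂ (γ vdc i₁ i₂ v₂ : ℝ) : ℝ :=
  1 / K.L * (-(K.R * i₂) - K.L * K.ωn * i₁ + K.μ / 2 * cos γ * vdc - v₂)

/-- Capacitor voltage, first component of `C v̇ = −(G I + C ω* J) v + i − i_net`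
[cite: JouiniSun2022, §2.1]: `C v̇₁ = −G v₁ + C ω* v₂ + i₁ − i_net,1`. -/
def dv₁ (i₁ v₁ v₂ inet₁ : ℝ) : ℝ := 1 / K.C * (-(K.G * v₁) + K.C * K.ωn * v₂ + i₁ - inet₁)

/-- Second component: `C v̇₂ = −G v₂ − C ω* v₁ + i₂ − i_net,2` [cite: JouiniSun2022, §2.1]. -/
def dv₂ (i₂ v₁ v₂ inet₂ : ℝ) : ℝ := 1 / K.C * (-(K.G * v₂) - K.C * K.ωn * v₁ + i₂ - inet₂)

/-- Polynomialised dc-link component: `sin γ ↦ s`, `cos γ ↦ c`; degree 2 in the states. -/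
def dvdcPoly (s c vdc i₁ i₂ : ℝ) : ℝ :=
  1 / K.Cdc * (-(K.Kp * (vdc - K.vdcRef)) - K.μ / 2 * (-s * i₁ + c * i₂) + K.idcRef)

/-- The polynomialised dc-link component agrees with the printed one under `(s, c) = (sin γ, cos γ)`;
together with `ṡ = c γ̇`, `ċ = −s γ̇` (chain rule, as in `InverterDroop.ReducedParams.embedding`) the
matching-control closed loop is a polynomial system of degree 2 on `{s² + c² = 1}` — no other
nonlinearity occurs in the printed model. -/
theorem dvdcPoly_sin_cos (γ vdc i₁ i₂ : ℝ) :
    K.dvdcPoly (sin γ) (cos γ) vdc i₁ i₂ = K.dvdc γ vdc i₁ i₂ := by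
  simp [dvdcPoly, dvdc, neg_mul]

/-- dc equilibrium: at `v_dc = v_dc*` the virtual frequency deviation `γ̇` vanishes. -/
theorem dγ_ref : K.dγ K.vdcRef = 0 := by simp [dγ]

end Matching

end Summit.Ventures.GridStability.Models.InverterVSM

end
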